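import Summits.QuantumFields.YangMills.Theorems.BackwardLiouvilleRigidityFlatRatioTermination

/-!
# Route `BackwardLiouvilleRigidity` (rev 17 = BLR «rev 14», R-n4 membership repair), support item `FlatRatioTerminationR` — BY NAME

`FlatRatioTerminationR` is the proved support `FlatRatioTermination` (stmt-QuantumFields-22542, `flatRatioTermination_proof`) with the
tower hypothesis block re-keyed to the R-n4 ∃κ-tilted membership clause
`(∃ κ : ℝ, MemAtHeight F ℰp j (prm j) (fun U => Real.exp κ * ρ j U)) ∧ (∃ κ : ℝ, … ρ' …)` (idea-crit-5 VERDICT #534 Q1/(b), #546 O2).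
The landed proof DISCARDS the membership conjuncts (`obtain ⟨hposj, hd, hd', -, -, -, -, -, -⟩ := hB j hj₀`), so this is that proof
verbatim against the R target, reusing the landed `innerWindowChains`, `stub_windowTV`, `stub_pushToZero`.

HONEST SCOPE.  A SUPPORT item (binder `hC2` of the route's `closes`) is re-landed in the repaired currency; the cruxes
`BackwardStabilityAdmFR` / `ClassLimitTrajectoriesAdmFR` / `OneStepBackwardContractionAdmFR`, rung R3 (`YM3TorusSU2`, finite-volume SU(2)
YM₃ on T³) and every summit statement stay OPEN; the Yang–Mills mass gap is NOT proved by any of this.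
-/

namespace Summit.QuantumFields.YangMills.Theorems.FlatRatioTermination

open Filter Topology MeasureTheory
open Literature.MathematicalPhysics.QuantumFieldTheory.Balaban1983to89
open Literature.MathematicalPhysics.QuantumFieldTheory.Balaban1983to89.T3ContinuumYM3Torus
open Literature.MathematicalPhysics.QuantumFieldTheory.Balaban1983to89.T3NestedUnitLaws
open Literature.MathematicalPhysics.QuantumFieldTheory.Balaban1983to89.T3UnitLawDensityEML
open Literature.MathematicalPhysics.QuantumFieldTheory.Balaban1983to89.T3UnitScaleTilt

/-- **`FlatRatioTerminationR` (stmt-QuantumFields-28297, support item `hC2` of route-QuantumFields-BackwardLiouvilleRigidity,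
rev 19 = BLR «rev 14» R-n4 membership repair) HOLDS**: the decaying-defect termination in the ∃κ-tilted membership frame.
Proof = the landed ✓22542 script `flatRatioTermination_proof` verbatim (it discards the membership conjuncts of the tower
block `hB`), composed from the tree theorems `innerWindowChains`, `stub_windowTV` (p647765), `stub_pushToZero` (p647387). [folklore] -/
theorem flatRatioTerminationR_proof : Summit.QuantumFields.YangMills.Theses.BackwardLiouvilleRigidity.FlatRatioTerminationR := by
  classical
  obtain ⟨pW, hW⟩ := innerWindowChains
  refine ⟨pW, 1, one_pos, ?_⟩
  intro F γ hγ hγ1 b₀ p₀ κ j₀ prm ω η hp hb₀ hκ hpos hη μ μ' ρ ρ' hc hc' hB hIn hosc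
  obtain ⟨jW, hjW⟩ := hW p₀ hp F γ b₀ hγ hγ1 hb₀
  obtain ⟨j₁, hj₀₁, τ, hτ, hlim⟩ := hosc
  refine stub_pushToZero F μ μ' hc hc' ?_
  intro ε hε
  obtain ⟨δ₀, hδ₀, hT⟩ := stub_windowTV ε hε
  have hη0 : Tendsto η atTop (𝓝 0) := hη.tendsto_atTop_zero
  obtain ⟨N₁, hN₁⟩ := eventually_atTop.mp (hlim.eventually (gt_mem_nhds hδ₀))
  obtain ⟨N₂, hN₂⟩ := eventually_atTop.mp (hη0.eventually (gt_mem_nhds hδ₀))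
  set j : ℕ := max (max j₀ j₁) (max jW (max N₁ N₂)) with hjdef
  have hj₀ : j₀ ≤ j := (le_max_left _ _).trans (le_max_left _ _)
  have hj₁ : j₁ ≤ j := (le_max_right _ _).trans (le_max_left _ _)
  have hjWj : jW ≤ j := (le_max_left _ _).trans (le_max_right _ _)
  have hN₁j : N₁ ≤ j := ((le_max_left _ _).trans (le_max_right _ _)).trans (le_max_right _ _)
  have hN₂j : N₂ ≤ j := ((le_max_right _ _).trans (le_max_right _ _)).trans (le_max_right _ _)
  refine ⟨j, ?_⟩
  obtain ⟨hposj, hd, hd', -, -, -, -, -, -⟩ := hB j hj₀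
  have hθin : 0 < Literature.MathematicalPhysics.QuantumFieldTheory.Balaban1983to89.T3UnitScaleTilt.θBal F.L γ (Real.sqrt b₀) (p₀ / 2) j :=
    Literature.MathematicalPhysics.QuantumFieldTheory.Balaban1983to89.T3MinimiserStabilityReduction.θBal_pos F.hL.2.le hγ hγ1 (Real.sqrt_pos.mpr hb₀) _ _
  have hτD : max (τ j) 0 * ((Fintype.card (Literature.MathematicalPhysics.QuantumFieldTheory.Balaban1983to89.PBond (F.P j) 0) ^ 2 : ℕ) : ℝ) ≤ δ₀ := by
    have h1 := hN₁ j hN₁j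
    rcases le_or_gt (τ j) 0 with hneg | hposτ
    · rw [max_eq_right hneg, zero_mul]; exact hδ₀.le
    · rw [max_eq_left hposτ.le]; push_cast; exact h1.le
  refine hT F j _ _ _ (max (τ j) 0) (η j) hθin (le_max_right _ _) hτD (hpos j).2 (hN₂ j hN₂j).le (μ j) (μ' j) (ρ j) (ρ' j) (hc j).1 (hc' j).1 hposj hd hd' (hjW j hjWj) ?_ (hIn j hj₀).1 (hIn j hj₀).2
  intro b U V hU hV hUV
  exact (hτ j hj₁ b U V hU hV hUV).trans (le_max_left _ _)

end Summit.QuantumFields.YangMills.Theorems.FlatRatioTermination
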